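import Summits.BirchSwinnertonDyer.BirchSwinnertonDyer.Theorems.ByReductionTypeAtTwoSupersingularUnitAnchorTransport
import Summits.BirchSwinnertonDyer.BirchSwinnertonDyer.Theorems.ThetaPartnerAtTwoSignedTransportAtTwoBridge
import HarnessLib

/-!
# Crux `SupersingularRankZeroAtTwo` (item stmt-BirchSwinnertonDyer-19097, route `ByReductionTypeAtTwo`, rung K4): the
# UNIT-ANCHOR TRANSPORT road, `Λ`-form — Kobayashi's FULL `+` main conjecture at `2` for `W` (hence BSD₂ WITHOUT a descent
# certificate) from a unit-zone anchor, the `μ`- AND `λ`-transport at the pair, and a per-class reading `μ = 0, λ ≤ ℓ*` of the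
# Néron-normalised `♭` function of `W` — no analytic transport (seat `bsd-2adic-ss-1x` GEN 4; companion of p558810)

HONEST FRAMING (cells `bsd-2adic` / `bsd-wall`; HUMAN RULINGS D-0036/D-0054/D-0074): THEOREMS ONLY — no definition, no named fact,
no instance, no `sorry`; every research input is an explicit hypothesis spelled inline; closes no item; BSD is NOT proved by any
of this. PARTITION (D-0054): X5@2 good-supersingular `a₂ = 0`, UNIT-ANCHOR sub-row (17/208; UNIT-ANCHOR-CENSUS-v1) × `p = 2` —
types-the-object-of; bears_on K4 19097 · TP2 K1 20333 (its algebraic `μ`- and `λ`-halves are the two transport binders used).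

WHAT. `SSUnitAnchor.bsdp_two_of_unitAnchor` (p558810) closes the Miller UPPER half by `μ`-transport and takes the LOWER half as a
descent certificate `hsha`. Here the lower half comes from `λ` instead (Greenberg–Vatsal's closing step, tp2-p1's bridge p512985
with the ANALYTIC TRANSPORT V2 replaced by a READING at `W` alone): at the unit-zone anchor `char X⁺(A) = Λ`, so `λ⁺(A) = 0`; the
`λ`-transport binder `hlamT` (B. D. Kim 2009 Cor. 2.13 `λ`-half ∘ Prop. 2.6 READ AT `2` at the pair, local terms already
evaluated: `λ(X⁺_W) = λ(X⁺_A) + ℓ*`, `ℓ* = Σ_{S₀}(δ(A) − δ(W))` with Matsuno's weights — the number the census tabulates per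
class) gives `λ(X⁺_W) = ℓ*`; Kato's divisibility `char X⁺_W = (g)`, `ι(g·h) = 2^m ϖ ι L♭_W` and the per-class CERT `hCert`
«`μ(G) = m` and `λ(G) ≤ ℓ*` for the frame's integral multiple `G` (`ι G = 2^m ϖ ι L♭_W`)» — i.e. `μ(ϖL♭_W) = 0`, `λ(ϖL♭_W) ≤ ℓ*`,
ENGINE-2's two readings — force `μ(h) = m`, `λ(h) = 0`, `h = 2^m·u`, and `(g·u)` is the Néron-normalised generator:
`KobayashiMainConjecture W 2 1` (`kobayashiMainConjecture_two_of_unitAnchor`), whence `BSDp W 2` by the tree's `a₂ = 0` door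
(`bsdp_two_of_unitAnchor_of_reading`, NO `hsha`). The inequality `λ_an ≥ λ_alg` is Kato's; `λ_an ≤ ℓ* = λ_alg` is the reading; no
congruence of `L`-functions (V2 / Vatsal / EPW) is used. CENSUS: on all 17 (indeed 62) classes ENGINE-2 reads `λ♭(W) = ℓ*` EXACTLY
(UNIT-ANCHOR-CENSUS-v1 §2), so `hCert` is inhabited per class by the readings of record (CERT-SS-E2). RESEARCH CONTENT per class:
{`hmuT`, `hlamT` (the two algebraic halves of K1 at `2`, CM-free, at the pair), (2′) at `W` and `A`, (4)ʳᵃᵗ at `W`}.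

References: [BDKim2009] Cor. 2.13, Cor. 2.5, Prop. 2.6; [GreenbergVatsal2000] Thm. (1.4), p. 2 (1)–(2), Prop. (2.4);
[Kobayashi2003] Thm. 1.2, Conjecture (p. 2), Thm. 4.1; [Kato2004Asterisque] Thm. 12.4–12.5 (3); [BDKim2013] Cor. 3.15;
[Matsuno2008] Cor. 2.3 / Lemma 2.4 (p. 418); [Washington1997] §7.1, §13.2; [Miller2011LMS] Def. 1.1; UNIT-ANCHOR-CENSUS-v1.md.
-/

set_option autoImplicit false
-- the Theorems namespace of this sub repeats the summit name by design (D-0017 nested layout)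
set_option linter.dupNamespace false

noncomputable section

open scoped Classical MatrixGroups ModularForm

open CongruenceSubgroup WeierstrassCurve Literature.NumberTheory.EllipticCurves
  Literature.NumberTheory.EllipticCurves.ModularForms Literature.NumberTheory.EllipticCurves.Sprung2017
  Literature.NumberTheory.EllipticCurves.Rank1Residual Literature.NumberTheory.EllipticCurves.Rank1Residual.Typed
  Literature.NumberTheory.EllipticCurves.Kobayashi2003 Literature.NumberTheory.EllipticCurves.IwasawaDual
  ZpExtension Summit.BirchSwinnertonDyer.Rank1Residual Summit.BirchSwinnertonDyer.Rank1Residual.Supersingular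
  Summit.BirchSwinnertonDyer.Rank1Residual.X5.O1 Summit.BirchSwinnertonDyer.Rank1Residual.X1.MuLambda

namespace Summit.BirchSwinnertonDyer.BirchSwinnertonDyer.Theorems

namespace SSUnitAnchor

section Pair

variable (W : WeierstrassCurve ℚ) [W.IsElliptic] [W.IsGloballyMinimal]
  (A : WeierstrassCurve ℚ) [A.IsElliptic] [A.IsGloballyMinimal]

/-- **UNIT-ANCHOR TRANSPORT, `Λ`-form: Kobayashi's `+` main conjecture at `2` for `W`.** Setting of
`missingUpperBoundAt_two_of_unitAnchor` (unit-zone anchor `A`, `W[2] ≃ A[2]`, PUB, (2′) at `W` and `A`, (4)ʳᵃᵗ at `W`,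
`μ`-transport `hmuT`) plus: `hlamT` — the `λ`-transport at the pair with its local terms evaluated to the numeral `ℓ` (B. D. Kim
2009 Cor. 2.13 / Prop. 2.6 READ AT `2`; research binder), and `hCert` — the READING at `W`: for every integral multiple `G`,
`ι G = 2^m ϖ ι L♭_W`, `μ(G) = m ∧ λ(G) ≤ ℓ` (ENGINE-2 certificate per class). Conclusion: `KobayashiMainConjecture W 2 1` (torsion
∧ `char X⁺_W = (ϖ L♭_W)` for every datum). Chain: §2 of p558810 at `A` (`char = Λ`, `λ⁺(A) = λ(1) = 0`), `hmuT` ⇒ `μ(g) = 0`,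
`hlamT` ⇒ `λ(g) = ℓ`, Kato ⇒ `g·h` with `μ(gh) = m`, `λ(gh) ≤ ℓ`; additivity ⇒ `μ(h) = m`, `λ(h) = 0` ⇒ `h = 2^m·u`.
[cite: BDKim2009, Cor. 2.13 and Prop. 2.6] [cite: GreenbergVatsal2000, Thm. (1.4) and Prop. (2.4)]
[cite: Kobayashi2003, Thm. 1.2, Thm. 4.1 and Conjecture (p. 2)] [cite: Kato2004Asterisque, Thm. 12.4–12.5 (3)]
[cite: Washington1997, §7.1 and §13.2] -/
theorem kobayashiMainConjecture_two_of_unitAnchor (hmod : nonempty_modularParametrizationData)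
    (hGZK : rank_eq_analyticRank_of_analyticRank_le_one)
    (h124 : Kato2004.thm12_4) (hX0 : Kato2004_fineSelmerDual_isTorsion)
    (hr : W.analyticRank = 0) (hss : GoodSS W 2) (ha : W.frobeniusTrace 2 = 0)
    (hAr : A.analyticRank = 0) (hAss : GoodSS A 2) (hAa : A.frobeniusTrace 2 = 0)
    (hTam : ¬ 2 ∣ A.tamagawaProduct) (hSha : ¬ 2 ∣ A.shaOrder)
    (e : WeierstrassCurve.geomTorsion W (2 : ℤ) ≃+ WeierstrassCurve.geomTorsion A (2 : ℤ))
    (he : ∀ (σ : Field.absoluteGaloisGroup ℚ) (P : WeierstrassCurve.geomTorsion W (2 : ℤ)), e (σ • P) = σ • e P)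
    (hEC : ∀ (κ : ZpExtension ℚ 2) (γ : Field.absoluteGaloisGroup ℚ),
          κ.IsCyclotomic → κ.IsTopGenerator γ → Finite (W.selmerGroupPInfty 2) →
          Finite (endInvariants (conjSignedSelmerInfty W κ 1 γ - 1)) ∧
            ∃ u : ℤ_[2]ˣ, (Nat.card (endInvariants (conjSignedSelmerInfty W κ 1 γ - 1)) : ℚ_[2]) =
              ((u : ℤ_[2]) : ℚ_[2]) * ((2 : ℕ) : ℚ_[2]) ^ (padicValNat 2 W.tamagawaProduct) *
                (Nat.card (W.selmerGroupPInfty 2) : ℚ_[2]) *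
                  (Nat.card (EndCoinvariants (conjSignedSelmerInfty W κ 1 γ - 1)) : ℚ_[2]))
    (hCK : ∀ (κ : ZpExtension ℚ 2) (γ : Field.absoluteGaloisGroup ℚ),
        κ.IsCyclotomic → κ.IsTopGenerator γ → IsCyclotomicVariable 2 γ →
        ∀ [NeZero (W.conductorNorm ℤ)] (f : CuspForm (Gamma0 (W.conductorNorm ℤ)) 2),
          IsNewformOf W f → ∀ (ϖ : ℚ), (ϖ : ℝ) * W.realPeriodRat = plusPeriod f →
        ∀ (Lplus Lminus : IwasawaAlgebra 2), IsPollackPair f 2 Lplus Lminus →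
        ∀ (D : SignedSelmerDualData W κ γ 1) [ContinuousSMul ℤ_[2] (W.tateModule 2)],
          ∃ (I : Kato2004.IwasawaH1Data W 2 κ γ) (Y : W.FineSelmerDualData κ γ)
            (P : Submodule (IwasawaAlgebra 2) (IwasawaAlgebra 2))
            (loc : I.H →ₗ[IwasawaAlgebra 2] P) (toX : P →ₗ[IwasawaAlgebra 2] D.X)
            (δ : D.X →ₗ[IwasawaAlgebra 2] Y.X) (Z : Submodule (IwasawaAlgebra 2) I.H)
            (G : IwasawaAlgebra 2),
            Function.Exact loc toX ∧ Function.Exact toX δ ∧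
            G ∈ Submodule.map (P.subtype ∘ₗ loc) Z ∧
            iwasawaToPowerSeries 2 G =
              PowerSeries.C (ϖ : ℚ_[2]) * iwasawaToPowerSeries 2 (kobayashiL 1 Lplus Lminus) ∧
            (∀ 𝔭 : PrimeSpectrum (IwasawaAlgebra 2), 𝔭.asIdeal.height = 1 →
              PowerSeries.C (2 : ℤ_[2]) ∉ 𝔭.asIdeal →
              Literature.NumberTheory.EllipticCurves.Module.lengthAt (IwasawaAlgebra 2) Y.X 𝔭 ≤
                Literature.NumberTheory.EllipticCurves.Module.lengthAt (IwasawaAlgebra 2) (I.H ⧸ Z) 𝔭))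
    (hECA : ∀ (κ : ZpExtension ℚ 2) (γ : Field.absoluteGaloisGroup ℚ),
          κ.IsCyclotomic → κ.IsTopGenerator γ → Finite (A.selmerGroupPInfty 2) →
          Finite (endInvariants (conjSignedSelmerInfty A κ 1 γ - 1)) ∧
            ∃ u : ℤ_[2]ˣ, (Nat.card (endInvariants (conjSignedSelmerInfty A κ 1 γ - 1)) : ℚ_[2]) =
              ((u : ℤ_[2]) : ℚ_[2]) * ((2 : ℕ) : ℚ_[2]) ^ (padicValNat 2 A.tamagawaProduct) *
                (Nat.card (A.selmerGroupPInfty 2) : ℚ_[2]) *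
                  (Nat.card (EndCoinvariants (conjSignedSelmerInfty A κ 1 γ - 1)) : ℚ_[2]))
    (hmuT : GoodSS W 2 → W.frobeniusTrace 2 = 0 → GoodSS A 2 → A.frobeniusTrace 2 = 0 →
      (∃ e : WeierstrassCurve.geomTorsion W (2 : ℤ) ≃+ WeierstrassCurve.geomTorsion A (2 : ℤ),
        ∀ (σ : Field.absoluteGaloisGroup ℚ) (P : WeierstrassCurve.geomTorsion W (2 : ℤ)), e (σ • P) = σ • e P) →
      ∀ (κ : ZpExtension ℚ 2) (γ : Field.absoluteGaloisGroup ℚ), κ.IsCyclotomic → κ.IsTopGenerator γ →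
      ∀ (D : SignedSelmerDualData W κ γ 1) (D' : SignedSelmerDualData A κ γ 1)
        [Module.Finite (IwasawaAlgebra 2) D.X] [Module.Finite (IwasawaAlgebra 2) D'.X],
        Module.IsTorsion (IwasawaAlgebra 2) D.X → Module.IsTorsion (IwasawaAlgebra 2) D'.X →
        D'.mu = 0 → D.mu = 0)
    (ℓ : ℕ)
    (hlamT : GoodSS W 2 → W.frobeniusTrace 2 = 0 → GoodSS A 2 → A.frobeniusTrace 2 = 0 →
      (∃ e : WeierstrassCurve.geomTorsion W (2 : ℤ) ≃+ WeierstrassCurve.geomTorsion A (2 : ℤ),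
        ∀ (σ : Field.absoluteGaloisGroup ℚ) (P : WeierstrassCurve.geomTorsion W (2 : ℤ)), e (σ • P) = σ • e P) →
      ∀ (κ : ZpExtension ℚ 2) (γ : Field.absoluteGaloisGroup ℚ), κ.IsCyclotomic → κ.IsTopGenerator γ →
      ∀ (D : SignedSelmerDualData W κ γ 1) (D' : SignedSelmerDualData A κ γ 1)
        [Module.Finite (IwasawaAlgebra 2) D.X] [Module.Finite (IwasawaAlgebra 2) D'.X],
        Module.IsTorsion (IwasawaAlgebra 2) D.X → Module.IsTorsion (IwasawaAlgebra 2) D'.X →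
        D.mu = 0 → D'.mu = 0 → lambdaInvariant 2 D.X = lambdaInvariant 2 D'.X + ℓ)
    (hCert : ∀ (κ : ZpExtension ℚ 2) (γ : Field.absoluteGaloisGroup ℚ),
        κ.IsCyclotomic → κ.IsTopGenerator γ → IsCyclotomicVariable 2 γ →
        ∀ [NeZero (W.conductorNorm ℤ)] (f : CuspForm (Gamma0 (W.conductorNorm ℤ)) 2),
          IsNewformOf W f → ∀ (ϖ : ℚ), (ϖ : ℝ) * W.realPeriodRat = plusPeriod f →
        ∀ (Lplus Lminus : IwasawaAlgebra 2), IsPollackPair f 2 Lplus Lminus →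
        ∀ (G : IwasawaAlgebra 2) (m : ℕ), iwasawaToPowerSeries 2 G =
            PowerSeries.C ((2 : ℚ_[2]) ^ m * (ϖ : ℚ_[2])) * iwasawaToPowerSeries 2 (kobayashiL 1 Lplus Lminus) →
          mu G = m ∧ lam G ≤ ℓ) :
    KobayashiMainConjecture W 2 1 := by
  intro κ γ hκ hγ hγ' _ f hf ϖ hϖ Lplus Lminus hPP D
  haveI : Module.Finite (IwasawaAlgebra 2) D.X := Kobayashi2003.SignedSelmerDualData.moduleFinite hγ D
  have hX : Module.IsTorsion (IwasawaAlgebra 2) D.X :=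
    ThetaPartnerXRoute.torsion_of_signedEulerChar_at W hGZK hr hEC κ γ hκ hγ D
  refine ⟨hX, ?_⟩
  -- Kato's divisibility at `W` (K3 shape)
  obtain ⟨g, h, m, hchar, hgh⟩ :=
    ThetaPartnerXRoute.katoUpTo_at_of_colemanKatoRat_at h124 hX0 W hCK κ γ hκ hγ hγ' f hf ϖ hϖ Lplus Lminus hPP D
  set ι := iwasawaToPowerSeries 2 with hι
  set L := kobayashiL (1 : ℤˣ) Lplus Lminus with hLdef
  have hL0 : PowerSeries.C (ϖ : ℚ_[2]) * ι L ≠ 0 := SignedTransportAtTwo.C_mul_iota_ne_zero hf hϖ hPP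
  have hgh0 : g * h ≠ 0 := by
    intro h0
    apply SignedTransportAtTwo.C_pow_mul_ne_zero m hL0
    rw [← hgh, h0, map_zero]
  have hg0 : g ≠ 0 := left_ne_zero_of_mul hgh0
  have hh0 : h ≠ 0 := right_ne_zero_of_mul hgh0
  -- the anchor's datum: torsion, `char = Λ`, `μ = 0`
  obtain ⟨DA⟩ := nonempty_signedSelmerDualData A κ (1 : ℤˣ) hγ
  obtain ⟨hfinA, hXA, hcharA, hμA⟩ :=
    torsion_and_charIdeal_eq_top_and_mu_eq_zero_of_unitZone A hmod hGZK hAr hECA hTam hSha κ γ hκ hγ DA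
  haveI := hfinA
  have hcharA' : DA.charIdeal = Ideal.span {(1 : IwasawaAlgebra 2)} := by rw [hcharA, Ideal.span_singleton_one]
  have hlamA : lambdaInvariant 2 DA.X = 0 := by
    rw [← Summit.BirchSwinnertonDyer.Rank1Residual.X1.ParitySqueeze.lam_generator_eq_lambdaInvariant DA.X hXA
      one_ne_zero hcharA']
    exact ((isUnit_iff_mu_eq_zero_and_lam_eq_zero (1 : IwasawaAlgebra 2)).mp isUnit_one).2.2
  -- transport: `μ(X⁺_W) = 0`, `λ(X⁺_W) = ℓ`
  have hμD : D.mu = 0 := hmuT hss ha hAss hAa ⟨e, he⟩ κ γ hκ hγ D DA hX hXA hμA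
  have hlamD : lambdaInvariant 2 D.X = ℓ := by
    rw [hlamT hss ha hAss hAa ⟨e, he⟩ κ γ hκ hγ D DA hX hXA hμD hμA, hlamA, zero_add]
  -- the reading at `W` on `G = g·h`
  obtain ⟨hμan, hlaman⟩ := hCert κ γ hκ hγ hγ' f hf ϖ hϖ Lplus Lminus hPP (g * h) m hgh
  -- generator lemmas and bookkeeping
  have hμg : mu g = 0 := by
    rw [Summit.BirchSwinnertonDyer.Rank1Residual.X1.MuPart.mu_generator_eq_muInvariant D.X hX hg0 hchar]
    exact hμD
  have hlamg : lam g = ℓ := by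
    rw [Summit.BirchSwinnertonDyer.Rank1Residual.X1.ParitySqueeze.lam_generator_eq_lambdaInvariant D.X hX hg0 hchar]
    exact hlamD
  rw [mu_mul hg0 hh0, hμg] at hμan
  rw [lam_mul hg0 hh0, hlamg] at hlaman
  have hμh : mu h = m := by omega
  have hlamh : lam h = 0 := by omega
  -- `h = 2^m · u`, and `g·u` is the Néron-normalised generator
  obtain ⟨u, hu⟩ := SignedTransportAtTwo.exists_unit_of_mu_of_lam hh0 hμh hlamh
  have h2m : (PowerSeries.C ((2 : ℚ_[2]) ^ m) : PowerSeries ℚ_[2]) ≠ 0 :=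
    (map_ne_zero_iff _ PowerSeries.C_injective).mpr (pow_ne_zero m two_ne_zero)
  have hιh : ι h = PowerSeries.C ((2 : ℚ_[2]) ^ m) * ι (u : IwasawaAlgebra 2) := by
    rw [hu, map_mul, hι, PowerSeries.map_C, map_pow, map_ofNat]
  refine ⟨g * u, ?_, ?_⟩
  · rw [hchar]; exact (Ideal.span_singleton_mul_right_unit u.isUnit g).symm
  · have key : PowerSeries.C ((2 : ℚ_[2]) ^ m) * ι (g * u) =
        PowerSeries.C ((2 : ℚ_[2]) ^ m) * (PowerSeries.C (ϖ : ℚ_[2]) * ι L) := by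
      calc PowerSeries.C ((2 : ℚ_[2]) ^ m) * ι (g * ↑u)
          = ι g * (PowerSeries.C ((2 : ℚ_[2]) ^ m) * ι ↑u) := by rw [map_mul]; ring
        _ = ι (g * h) := by rw [map_mul, hιh]
        _ = PowerSeries.C ((2 : ℚ_[2]) ^ m * (ϖ : ℚ_[2])) * ι L := hgh
        _ = PowerSeries.C ((2 : ℚ_[2]) ^ m) * (PowerSeries.C (ϖ : ℚ_[2]) * ι L) := by rw [map_mul, mul_assoc]
    exact mul_left_cancel₀ h2m key

/-- **UNIT-ANCHOR TRANSPORT, `Λ`-form: BSD₂ WITHOUT a descent certificate.** `kobayashiMainConjecture_two_of_unitAnchor` +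
Kim's control term at `W` (from (2′)) + the tree's `a₂ = 0` door `bsdp_two_of_kobayashiMainConjecture_two_of_frobeniusTrace_eq_zero`
⟹ `BSDp W 2`. Displayed research content: `hmuT`, `hlamT` (the two algebraic halves of K1 at `2`, at the pair), (2′) at `W`
and `A`, (4)ʳᵃᵗ at `W`; CERT: unit zone of `A`, `W[2] ≃ A[2]`, the reading `hCert`. No `hsha`, no V2, no CM, no Burungale–Flach.
[cite: Kobayashi2003, Thm. 1.2 and Conjecture (p. 2)] [cite: BDKim2013, Cor. 3.15] [cite: BDKim2009, Cor. 2.13]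
[cite: Kato2004Asterisque, Thm. 12.5 (3)] [cite: Miller2011LMS, Def. 1.1] -/
theorem bsdp_two_of_unitAnchor_of_reading (hmod : nonempty_modularParametrizationData)
    (hGZK : rank_eq_analyticRank_of_analyticRank_le_one)
    (h124 : Kato2004.thm12_4) (hX0 : Kato2004_fineSelmerDual_isTorsion)
    (hr : W.analyticRank = 0) (hss : GoodSS W 2) (ha : W.frobeniusTrace 2 = 0)
    (hAr : A.analyticRank = 0) (hAss : GoodSS A 2) (hAa : A.frobeniusTrace 2 = 0)
    (hTam : ¬ 2 ∣ A.tamagawaProduct) (hSha : ¬ 2 ∣ A.shaOrder)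
    (e : WeierstrassCurve.geomTorsion W (2 : ℤ) ≃+ WeierstrassCurve.geomTorsion A (2 : ℤ))
    (he : ∀ (σ : Field.absoluteGaloisGroup ℚ) (P : WeierstrassCurve.geomTorsion W (2 : ℤ)), e (σ • P) = σ • e P)
    (hEC : ∀ (κ : ZpExtension ℚ 2) (γ : Field.absoluteGaloisGroup ℚ),
          κ.IsCyclotomic → κ.IsTopGenerator γ → Finite (W.selmerGroupPInfty 2) →
          Finite (endInvariants (conjSignedSelmerInfty W κ 1 γ - 1)) ∧
            ∃ u : ℤ_[2]ˣ, (Nat.card (endInvariants (conjSignedSelmerInfty W κ 1 γ - 1)) : ℚ_[2]) =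
              ((u : ℤ_[2]) : ℚ_[2]) * ((2 : ℕ) : ℚ_[2]) ^ (padicValNat 2 W.tamagawaProduct) *
                (Nat.card (W.selmerGroupPInfty 2) : ℚ_[2]) *
                  (Nat.card (EndCoinvariants (conjSignedSelmerInfty W κ 1 γ - 1)) : ℚ_[2]))
    (hCK : ∀ (κ : ZpExtension ℚ 2) (γ : Field.absoluteGaloisGroup ℚ),
        κ.IsCyclotomic → κ.IsTopGenerator γ → IsCyclotomicVariable 2 γ →
        ∀ [NeZero (W.conductorNorm ℤ)] (f : CuspForm (Gamma0 (W.conductorNorm ℤ)) 2),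
          IsNewformOf W f → ∀ (ϖ : ℚ), (ϖ : ℝ) * W.realPeriodRat = plusPeriod f →
        ∀ (Lplus Lminus : IwasawaAlgebra 2), IsPollackPair f 2 Lplus Lminus →
        ∀ (D : SignedSelmerDualData W κ γ 1) [ContinuousSMul ℤ_[2] (W.tateModule 2)],
          ∃ (I : Kato2004.IwasawaH1Data W 2 κ γ) (Y : W.FineSelmerDualData κ γ)
            (P : Submodule (IwasawaAlgebra 2) (IwasawaAlgebra 2))
            (loc : I.H →ₗ[IwasawaAlgebra 2] P) (toX : P →ₗ[IwasawaAlgebra 2] D.X)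
            (δ : D.X →ₗ[IwasawaAlgebra 2] Y.X) (Z : Submodule (IwasawaAlgebra 2) I.H)
            (G : IwasawaAlgebra 2),
            Function.Exact loc toX ∧ Function.Exact toX δ ∧
            G ∈ Submodule.map (P.subtype ∘ₗ loc) Z ∧
            iwasawaToPowerSeries 2 G =
              PowerSeries.C (ϖ : ℚ_[2]) * iwasawaToPowerSeries 2 (kobayashiL 1 Lplus Lminus) ∧
            (∀ 𝔭 : PrimeSpectrum (IwasawaAlgebra 2), 𝔭.asIdeal.height = 1 →
              PowerSeries.C (2 : ℤ_[2]) ∉ 𝔭.asIdeal →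
              Literature.NumberTheory.EllipticCurves.Module.lengthAt (IwasawaAlgebra 2) Y.X 𝔭 ≤
                Literature.NumberTheory.EllipticCurves.Module.lengthAt (IwasawaAlgebra 2) (I.H ⧸ Z) 𝔭))
    (hECA : ∀ (κ : ZpExtension ℚ 2) (γ : Field.absoluteGaloisGroup ℚ),
          κ.IsCyclotomic → κ.IsTopGenerator γ → Finite (A.selmerGroupPInfty 2) →
          Finite (endInvariants (conjSignedSelmerInfty A κ 1 γ - 1)) ∧
            ∃ u : ℤ_[2]ˣ, (Nat.card (endInvariants (conjSignedSelmerInfty A κ 1 γ - 1)) : ℚ_[2]) =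
              ((u : ℤ_[2]) : ℚ_[2]) * ((2 : ℕ) : ℚ_[2]) ^ (padicValNat 2 A.tamagawaProduct) *
                (Nat.card (A.selmerGroupPInfty 2) : ℚ_[2]) *
                  (Nat.card (EndCoinvariants (conjSignedSelmerInfty A κ 1 γ - 1)) : ℚ_[2]))
    (hmuT : GoodSS W 2 → W.frobeniusTrace 2 = 0 → GoodSS A 2 → A.frobeniusTrace 2 = 0 →
      (∃ e : WeierstrassCurve.geomTorsion W (2 : ℤ) ≃+ WeierstrassCurve.geomTorsion A (2 : ℤ),
        ∀ (σ : Field.absoluteGaloisGroup ℚ) (P : WeierstrassCurve.geomTorsion W (2 : ℤ)), e (σ • P) = σ • e P) →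
      ∀ (κ : ZpExtension ℚ 2) (γ : Field.absoluteGaloisGroup ℚ), κ.IsCyclotomic → κ.IsTopGenerator γ →
      ∀ (D : SignedSelmerDualData W κ γ 1) (D' : SignedSelmerDualData A κ γ 1)
        [Module.Finite (IwasawaAlgebra 2) D.X] [Module.Finite (IwasawaAlgebra 2) D'.X],
        Module.IsTorsion (IwasawaAlgebra 2) D.X → Module.IsTorsion (IwasawaAlgebra 2) D'.X →
        D'.mu = 0 → D.mu = 0)
    (ℓ : ℕ)
    (hlamT : GoodSS W 2 → W.frobeniusTrace 2 = 0 → GoodSS A 2 → A.frobeniusTrace 2 = 0 →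
      (∃ e : WeierstrassCurve.geomTorsion W (2 : ℤ) ≃+ WeierstrassCurve.geomTorsion A (2 : ℤ),
        ∀ (σ : Field.absoluteGaloisGroup ℚ) (P : WeierstrassCurve.geomTorsion W (2 : ℤ)), e (σ • P) = σ • e P) →
      ∀ (κ : ZpExtension ℚ 2) (γ : Field.absoluteGaloisGroup ℚ), κ.IsCyclotomic → κ.IsTopGenerator γ →
      ∀ (D : SignedSelmerDualData W κ γ 1) (D' : SignedSelmerDualData A κ γ 1)
        [Module.Finite (IwasawaAlgebra 2) D.X] [Module.Finite (IwasawaAlgebra 2) D'.X],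
        Module.IsTorsion (IwasawaAlgebra 2) D.X → Module.IsTorsion (IwasawaAlgebra 2) D'.X →
        D.mu = 0 → D'.mu = 0 → lambdaInvariant 2 D.X = lambdaInvariant 2 D'.X + ℓ)
    (hCert : ∀ (κ : ZpExtension ℚ 2) (γ : Field.absoluteGaloisGroup ℚ),
        κ.IsCyclotomic → κ.IsTopGenerator γ → IsCyclotomicVariable 2 γ →
        ∀ [NeZero (W.conductorNorm ℤ)] (f : CuspForm (Gamma0 (W.conductorNorm ℤ)) 2),
          IsNewformOf W f → ∀ (ϖ : ℚ), (ϖ : ℝ) * W.realPeriodRat = plusPeriod f →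
        ∀ (Lplus Lminus : IwasawaAlgebra 2), IsPollackPair f 2 Lplus Lminus →
        ∀ (G : IwasawaAlgebra 2) (m : ℕ), iwasawaToPowerSeries 2 G =
            PowerSeries.C ((2 : ℚ_[2]) ^ m * (ϖ : ℚ_[2])) * iwasawaToPowerSeries 2 (kobayashiL 1 Lplus Lminus) →
          mu G = m ∧ lam G ≤ ℓ) :
    BSDp W 2 := by
  have hLrat : hasEntireLFunction_rat := WeierstrassCurve.hasEntireLFunction_rat_of_exists_isNewformOf
    (exists_isNewformOf_of_nonempty_modularParametrizationData hmod)
  have hL : W.entireLFunction 1 ≠ 0 := (W.analyticRank_eq_zero_iff_holds (hLrat W)).mp hr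
  have h12 : ∀ (κ : ZpExtension ℚ 2) (γ : Field.absoluteGaloisGroup ℚ), κ.IsCyclotomic → κ.IsTopGenerator γ →
      ∀ D : SignedSelmerDualData W κ γ 1, Module.Finite (IwasawaAlgebra 2) D.X :=
    fun κ γ _ hγ D => Kobayashi2003.SignedSelmerDualData.moduleFinite hγ D
  exact bsdp_two_of_kobayashiMainConjecture_two_of_frobeniusTrace_eq_zero W hmod hGZK hss.1 ha hL h12
    (ThetaPartnerXRoute.kimTerm_of_signedEulerChar_at W hEC)
    (kobayashiMainConjecture_two_of_unitAnchor W A hmod hGZK h124 hX0 hr hss ha hAr hAss hAa hTam hSha e he hEC hCK hECA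
      hmuT ℓ hlamT hCert)

end Pair

end SSUnitAnchor

end Summit.BirchSwinnertonDyer.BirchSwinnertonDyer.Theorems

end
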